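import Mathlib
import Summits.NavierStokesRegularity.NavierStokesRegularity.Theorems.EulerZoomLiouvillePowerGaugeEulerLiouvillePressureFloorVirialMass
import Literature.Analysis.FluidPDE.ChaeEulerLiouville
import Literature.Analysis.FluidPDE.WeakSolutionProofs
import HarnessLib

/-!
# Crux `EulerZoomLiouville.PowerGaugeEulerLiouville` (stmt-NavierStokesRegularity-19832), line `pressure-floor`, stub A1 — part 2:
# THE SLICEWISE WEIGHTED VIRIAL IDENTITY FOR EVERY NEWTONIAN WEIGHT (`stub_weightedVirial`, signature unfolded)

Route №10 `EulerZoomLiouville` (NavierStokesRegularity), crux E.  Line `pressure-floor` (ideator ns-idea-11;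
`Cruxes/PowerGaugeEulerLiouville/Lines/pressure_floor.lean`), registered stub `stub_weightedVirial` (A1), proved here with its
signature UNFOLDED in the tree's vocabulary (the line's `InClass`, `IsNewtonianWeight`, `WeightedVirial` are `def`s of the Cruxes
file; the statement below is their `δ`-unfolding, so the skeleton fills the stub by `exact`).

THE STATEMENT.  For every member `(u, p, H, c)` of Seregin's power-gauged ancient Euler class (`ρ > 0`) and every NEWTONIAN WEIGHT
`Φ` (smooth, `|Φ| ≤ K/(1+|x|)`, `|∇Φ| ≤ K/(1+|x|)²`, `|D²Φ(x)(v,v)| ≤ K|v|²/(1+|x|)³`): for a.e. `t < 0` the slice functions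
`x ↦ D²Φ(x)(u(t,x),u(t,x))` and `x ↦ p(t,x) ΔΦ(x)` are integrable on `ℝ³` and `∫ D²Φ(u,u) dx + ∫ p ΔΦ dx = 0`.

THE PROOF (the route of the line card, A1).  On each window `I_n = (−n−1, 0)` the member is a distributional Euler solution on the
slab `I_n × ℝ³` (`IsDistributionalNSSolutionOn.mono_holds`); the six integrability hypotheses of the tree's weighted Chae identity
`IsDistributionalNSSolutionOn.ae_integral_hessian_apply_add_integral_pressure_mul_laplacian_eq_zero` with the tidal majorant
`w = K(1+|x|)^{-3}` are all dominated by `K |u|² (1+|x|)^{-3}` and `K |p| (1+|x|)^{-3}`, integrable on `I_n × ℝ³` by part 1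
(`…PressureFloorVirialMass`: dyadic summation of the `A`- and `D`-gauges); the identity follows for a.e. `t ∈ I_n`; the slice
integrability for a.e. `t` is Fubini (`Integrable.prod_right_ae`) applied to the dominated space–time integrands; finally
`(−∞,0) = ⋃_n I_n`.

* `laplacian_eq_sum_hessian`, `abs_laplacian_le` — `ΔΦ = Σᵢ D²Φ(eᵢ,eᵢ)`, `|ΔΦ| ≤ 3 w`;
* `integrable_weightedMass_sq`, `integrable_weightedMass_pressure` — part 1 repackaged as Bochner integrability;
* `weightedVirial_window` — identity + slice integrability on one window;
* **`weightedVirial_of_inClass`** — the stub signature, unfolded.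

WHAT THIS IS NOT: not NS, not the crux — a helper `--supports` stmt-19832 on the line `pressure-floor`; no summit statement is proved
here.  [cite: Chae2008Weighted, Thm 1.1 (proof, §2); Chae2011, Thm 1.1 (proof, (21)–(24)); CaffarelliKohnNirenberg1982, §2]
-/

noncomputable section

-- flat `Theorems/<Route><Decl>…` files of one crux share the namespace of the crux (tree convention)
set_option linter.dupNamespace false

open MeasureTheory Set Filter Topology Metric Function
open scoped NNReal ENNReal Laplacian RealInnerProductSpace ContDiff

namespace Summit.NavierStokesRegularity.NavierStokesRegularity.Theorems.PowerGaugeEulerLiouville.PressureFloor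

open Literature.Analysis Literature.Analysis.FluidPDE

variable {u : ℝ → EuclideanSpace ℝ (Fin 3) → EuclideanSpace ℝ (Fin 3)} {p : ℝ → EuclideanSpace ℝ (Fin 3) → ℝ}

/-! ### The Laplacian against the Hessian bound -/

/-- `ΔΦ(x) = Σᵢ D²Φ(x)(eᵢ, eᵢ)` in the standard orthonormal frame (Mathlib's `laplacian_eq_iteratedFDeriv_stdOrthonormalBasis`). [folklore] -/
theorem laplacian_eq_sum_hessian (Φ : EuclideanSpace ℝ (Fin 3) → ℝ) (x : EuclideanSpace ℝ (Fin 3)) :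
    Δ Φ x = ∑ i, fderiv ℝ (fderiv ℝ Φ) x (stdOrthonormalBasis ℝ (EuclideanSpace ℝ (Fin 3)) i)
      (stdOrthonormalBasis ℝ (EuclideanSpace ℝ (Fin 3)) i) := by
  rw [InnerProductSpace.laplacian_eq_iteratedFDeriv_stdOrthonormalBasis]
  simp only [iteratedFDeriv_two_apply]
  rfl

/-- A Hessian bound `|D²Φ(x)(v,v)| ≤ w(x)|v|²` bounds the Laplacian: `|ΔΦ(x)| ≤ 3 w(x)` (three unit vectors). [folklore] -/
theorem abs_laplacian_le {Φ : EuclideanSpace ℝ (Fin 3) → ℝ} {w : EuclideanSpace ℝ (Fin 3) → ℝ}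
    (hw : ∀ x v, |fderiv ℝ (fderiv ℝ Φ) x v v| ≤ w x * ‖v‖ ^ 2) (x : EuclideanSpace ℝ (Fin 3)) :
    |Δ Φ x| ≤ 3 * w x := by
  set b := stdOrthonormalBasis ℝ (EuclideanSpace ℝ (Fin 3)) with hb
  rw [laplacian_eq_sum_hessian]
  refine (Finset.abs_sum_le_sum_abs _ _).trans ?_
  have h1 : ∀ i, |fderiv ℝ (fderiv ℝ Φ) x (b i) (b i)| ≤ w x := fun i => by
    have := hw x (b i)
    rwa [b.orthonormal.1 i, one_pow, mul_one] at this
  calc ∑ i, |fderiv ℝ (fderiv ℝ Φ) x (b i) (b i)| ≤ ∑ _i : Fin (Module.finrank ℝ (EuclideanSpace ℝ (Fin 3))), w x :=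
        Finset.sum_le_sum fun i _ => h1 i
    _ = 3 * w x := by
        rw [Finset.sum_const, Finset.card_univ, Fintype.card_fin, finrank_euclideanSpace_fin, nsmul_eq_mul]
        norm_num

/-! ### Part 1 repackaged: Bochner integrability of the two weighted masses on a window -/

/-- **`|u|²(1+|x|)^{-3}` is integrable on every finite past window** (part 1 + measurability). [folklore] -/
theorem integrable_weightedMass_sq {ρ : ℝ} (hρ : 0 ≤ ρ) {c : ℝ≥0}
    (hum : AEStronglyMeasurable (uncurry u) (volume.restrict (Iio (0 : ℝ) ×ˢ (univ : Set (EuclideanSpace ℝ (Fin 3))))))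
    (hA : ∀ a : ℝ, 0 < a → ENNReal.ofReal (a ^ (2 * ρ)) * cknA a (0 : ℝ × EuclideanSpace ℝ (Fin 3)) u ≤ (c : ℝ≥0∞))
    {α β : ℝ} (hαβ : α < β) (hβ : β ≤ 0) :
    Integrable (fun z : ℝ × EuclideanSpace ℝ (Fin 3) => ‖u z.1 z.2‖ ^ 2 * ((1 + ‖z.2‖) ^ 3)⁻¹)
      (volume.restrict (Ioo α β ×ˢ (univ : Set (EuclideanSpace ℝ (Fin 3))))) := by
  have hWs : Ioo α β ⊆ Iio (0 : ℝ) := fun s hs => lt_of_lt_of_le hs.2 hβ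
  have hum' : AEStronglyMeasurable (uncurry u) (volume.restrict (Ioo α β ×ˢ (univ : Set (EuclideanSpace ℝ (Fin 3))))) :=
    hum.mono_measure (Measure.restrict_mono (prod_mono hWs Subset.rfl) le_rfl)
  have hwc : Continuous fun z : ℝ × EuclideanSpace ℝ (Fin 3) => ((1 + ‖z.2‖) ^ 3)⁻¹ :=
    Continuous.inv₀ ((continuous_const.add continuous_snd.norm).pow 3) fun z => by positivity
  refine ⟨(hum'.norm.pow 2).mul hwc.aestronglyMeasurable, ?_⟩
  have h := lintegral_sq_weight3_lt_top hρ hum hA hαβ hβ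
  refine lt_of_le_of_lt (lintegral_mono fun z => le_of_eq ?_) h
  have h0 : 0 ≤ ‖u z.1 z.2‖ ^ 2 * ((1 + ‖z.2‖) ^ 3)⁻¹ := by positivity
  rw [Real.enorm_eq_ofReal h0, ENNReal.ofReal_mul (by positivity), ENNReal.ofReal_pow (norm_nonneg _), ofReal_norm]

/-- **`|p|(1+|x|)^{-3}` is integrable on every finite past window** (part 1 + measurability). [folklore] -/
theorem integrable_weightedMass_pressure {ρ : ℝ} (hρ : 0 ≤ ρ) {c : ℝ≥0}
    (hpm : AEStronglyMeasurable (uncurry p) (volume.restrict (Iio (0 : ℝ) ×ˢ (univ : Set (EuclideanSpace ℝ (Fin 3))))))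
    (hD : ∀ a : ℝ, 0 < a → ENNReal.ofReal (a ^ (2 * ρ)) * cknD a (0 : ℝ × EuclideanSpace ℝ (Fin 3)) p ≤ (c : ℝ≥0∞))
    {α β : ℝ} (hαβ : α < β) (hβ : β ≤ 0) :
    Integrable (fun z : ℝ × EuclideanSpace ℝ (Fin 3) => |p z.1 z.2| * ((1 + ‖z.2‖) ^ 3)⁻¹)
      (volume.restrict (Ioo α β ×ˢ (univ : Set (EuclideanSpace ℝ (Fin 3))))) := by
  have hWs : Ioo α β ⊆ Iio (0 : ℝ) := fun s hs => lt_of_lt_of_le hs.2 hβ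
  have hpm' : AEStronglyMeasurable (uncurry p) (volume.restrict (Ioo α β ×ˢ (univ : Set (EuclideanSpace ℝ (Fin 3))))) :=
    hpm.mono_measure (Measure.restrict_mono (prod_mono hWs Subset.rfl) le_rfl)
  have hwc : Continuous fun z : ℝ × EuclideanSpace ℝ (Fin 3) => ((1 + ‖z.2‖) ^ 3)⁻¹ :=
    Continuous.inv₀ ((continuous_const.add continuous_snd.norm).pow 3) fun z => by positivity
  refine ⟨hpm'.norm.mul hwc.aestronglyMeasurable, ?_⟩
  have h := lintegral_pressure_weight3_lt_top hρ hpm hD hαβ hβ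
  refine lt_of_le_of_lt (lintegral_mono fun z => le_of_eq ?_) h
  have h0 : 0 ≤ |p z.1 z.2| * ((1 + ‖z.2‖) ^ 3)⁻¹ := by positivity
  rw [Real.enorm_eq_ofReal h0, ENNReal.ofReal_mul (abs_nonneg _), ← Real.norm_eq_abs, ofReal_norm]

/-! ### The identity and the slice integrability on one window -/

/-- **The weighted virial identity on one past window.**  For a member of the class (`ρ ≥ 0` suffices here) and a Newtonian weight
`Φ` with constant `K`, on the window `(α, β)`, `α < β ≤ 0`: for a.e. `t ∈ (α,β)` both slice integrands are integrable and
`∫ D²Φ(u(t),u(t)) + ∫ p(t) ΔΦ = 0` (the tree's weighted Chae identity with `w = K(1+|x|)^{-3}`; the six hypotheses and the two slice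
integrands are dominated by `K|u|²(1+|x|)^{-3}`, `3K|p|(1+|x|)^{-3}`). [cite: Chae2008Weighted, Thm 1.1 (proof, §2)] -/
theorem weightedVirial_window {ρ : ℝ} (hρ : 0 ≤ ρ) {c : ℝ≥0}
    (hsw : IsSuitableWeakSolutionOn (slab (EuclideanSpace ℝ (Fin 3)) (Iio 0) isOpen_Iio) 0 0 u p)
    (hum : AEStronglyMeasurable (uncurry u) (volume.restrict (Iio (0 : ℝ) ×ˢ (univ : Set (EuclideanSpace ℝ (Fin 3))))))
    (hpm : AEStronglyMeasurable (uncurry p) (volume.restrict (Iio (0 : ℝ) ×ˢ (univ : Set (EuclideanSpace ℝ (Fin 3))))))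
    (hA : ∀ a : ℝ, 0 < a → ENNReal.ofReal (a ^ (2 * ρ)) * cknA a (0 : ℝ × EuclideanSpace ℝ (Fin 3)) u ≤ (c : ℝ≥0∞))
    (hD : ∀ a : ℝ, 0 < a → ENNReal.ofReal (a ^ (2 * ρ)) * cknD a (0 : ℝ × EuclideanSpace ℝ (Fin 3)) p ≤ (c : ℝ≥0∞))
    {Φ : EuclideanSpace ℝ (Fin 3) → ℝ} (hΦ : ContDiff ℝ ∞ Φ) {K : ℝ}
    (hK : ∀ x : EuclideanSpace ℝ (Fin 3), |Φ x| ≤ K / (1 + ‖x‖) ∧ ‖fderiv ℝ Φ x‖ ≤ K / (1 + ‖x‖) ^ 2 ∧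
      ∀ v : EuclideanSpace ℝ (Fin 3), |fderiv ℝ (fderiv ℝ Φ) x v v| ≤ K / (1 + ‖x‖) ^ 3 * ‖v‖ ^ 2)
    {α β : ℝ} (hαβ : α < β) (hβ : β ≤ 0) :
    ∀ᵐ t ∂(volume.restrict (Ioo α β)),
      Integrable (fun x : EuclideanSpace ℝ (Fin 3) => fderiv ℝ (fderiv ℝ Φ) x (u t x) (u t x)) ∧
        Integrable (fun x : EuclideanSpace ℝ (Fin 3) => p t x * Δ Φ x) ∧
          (∫ x, fderiv ℝ (fderiv ℝ Φ) x (u t x) (u t x)) + ∫ x, p t x * Δ Φ x = 0 := by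
  set I : Set ℝ := Ioo α β with hI
  set μ : Measure (ℝ × EuclideanSpace ℝ (Fin 3)) := volume.restrict (I ×ˢ (univ : Set (EuclideanSpace ℝ (Fin 3)))) with hμ
  have hWs : I ⊆ Iio (0 : ℝ) := fun s hs => lt_of_lt_of_le hs.2 hβ
  have hum' : AEStronglyMeasurable (uncurry u) μ := hum.mono_measure (Measure.restrict_mono (prod_mono hWs Subset.rfl) le_rfl)
  have hpm' : AEStronglyMeasurable (uncurry p) μ := hpm.mono_measure (Measure.restrict_mono (prod_mono hWs Subset.rfl) le_rfl)
  -- the constant is nonnegative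
  have hK0 : 0 ≤ K := by
    have h := (hK 0).1
    rw [norm_zero, add_zero, div_one] at h
    exact (abs_nonneg _).trans h
  -- the weight and its continuity
  set w : EuclideanSpace ℝ (Fin 3) → ℝ := fun x => K / (1 + ‖x‖) ^ 3 with hw
  have hpos1 : ∀ x : EuclideanSpace ℝ (Fin 3), 0 < 1 + ‖x‖ := fun x => by positivity
  have hwK : ∀ x : EuclideanSpace ℝ (Fin 3), w x = K * ((1 + ‖x‖) ^ 3)⁻¹ := fun x => by
    show K / (1 + ‖x‖) ^ 3 = _
    rw [div_eq_mul_inv]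
  have hw0 : ∀ x, 0 ≤ w x := fun x => by rw [hwK]; positivity
  have hwH : ∀ x v, |fderiv ℝ (fderiv ℝ Φ) x v v| ≤ w x * ‖v‖ ^ 2 := fun x v => (hK x).2.2 v
  -- regularity of `Φ`
  have hΦ2 : ContDiff ℝ 2 Φ := contDiff_infty.1 hΦ 2
  have hΦ3 : ContDiff ℝ 3 Φ := contDiff_infty.1 hΦ 3
  have hΦc : Continuous Φ := hΦ.continuous
  have hD1c : Continuous (fderiv ℝ Φ) := hΦ2.continuous_fderiv (by simp)
  have hD2c : Continuous (fderiv ℝ (fderiv ℝ Φ)) := (hΦ3.fderiv_right (m := 2) le_rfl).continuous_fderiv (by simp)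
  have hLc : Continuous (Δ Φ) := by
    have : Δ Φ = fun x => ∑ i, fderiv ℝ (fderiv ℝ Φ) x (stdOrthonormalBasis ℝ (EuclideanSpace ℝ (Fin 3)) i)
        (stdOrthonormalBasis ℝ (EuclideanSpace ℝ (Fin 3)) i) := funext (laplacian_eq_sum_hessian Φ)
    rw [this]
    exact continuous_finsetSum _ fun i _ => (hD2c.clm_apply continuous_const).clm_apply continuous_const
  -- the two dominating integrable functions
  have hgU := (integrable_weightedMass_sq hρ hum hA hαβ hβ).const_mul K
  have hgP := (integrable_weightedMass_pressure hρ hpm hD hαβ hβ).const_mul K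
  have hgP3 := (integrable_weightedMass_pressure hρ hpm hD hαβ hβ).const_mul (3 * K)
  -- measurability helpers on the window
  have hu2m : AEStronglyMeasurable (fun z : ℝ × EuclideanSpace ℝ (Fin 3) => ‖u z.1 z.2‖ ^ 2) μ := hum'.norm.pow 2
  have hpam : AEStronglyMeasurable (fun z : ℝ × EuclideanSpace ℝ (Fin 3) => |p z.1 z.2|) μ := hpm'.norm
  have cont_ae : ∀ {g : EuclideanSpace ℝ (Fin 3) → ℝ}, Continuous g →
      AEStronglyMeasurable (fun z : ℝ × EuclideanSpace ℝ (Fin 3) => g z.2) μ := fun hg =>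
    (hg.comp continuous_snd).aestronglyMeasurable
  have hwc : Continuous w := by
    rw [hw]; exact continuous_const.div ((continuous_const.add continuous_norm).pow 3) fun x => by positivity
  have hq1c : Continuous fun x : EuclideanSpace ℝ (Fin 3) => ‖fderiv ℝ Φ x‖ / (1 + ‖x‖) :=
    hD1c.norm.div (continuous_const.add continuous_norm) fun x => (hpos1 x).ne'
  have hq2c : Continuous fun x : EuclideanSpace ℝ (Fin 3) => |Φ x| / (1 + ‖x‖) ^ 2 :=
    hΦc.abs.div ((continuous_const.add continuous_norm).pow 2) fun x => by positivity
  -- pointwise comparisons of the three weights with `K (1+|x|)^{-3}`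
  have hW1 : ∀ x : EuclideanSpace ℝ (Fin 3), ‖fderiv ℝ Φ x‖ / (1 + ‖x‖) ≤ K * ((1 + ‖x‖) ^ 3)⁻¹ := by
    intro x
    rw [div_le_iff₀ (hpos1 x)]
    calc ‖fderiv ℝ Φ x‖ ≤ K / (1 + ‖x‖) ^ 2 := (hK x).2.1
      _ = K * ((1 + ‖x‖) ^ 3)⁻¹ * (1 + ‖x‖) := by field_simp
  have hW2 : ∀ x : EuclideanSpace ℝ (Fin 3), |Φ x| / (1 + ‖x‖) ^ 2 ≤ K * ((1 + ‖x‖) ^ 3)⁻¹ := by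
    intro x
    rw [div_le_iff₀ (by positivity)]
    calc |Φ x| ≤ K / (1 + ‖x‖) := (hK x).1
      _ = K * ((1 + ‖x‖) ^ 3)⁻¹ * (1 + ‖x‖) ^ 2 := by field_simp
  -- the six integrability hypotheses
  have hI1 : IntegrableOn (fun z : ℝ × EuclideanSpace ℝ (Fin 3) => ‖u z.1 z.2‖ ^ 2 * w z.2) (I ×ˢ univ) volume := by
    refine hgU.mono' (hu2m.mul (cont_ae hwc)) (Eventually.of_forall fun z => ?_)
    rw [Real.norm_eq_abs, abs_of_nonneg (mul_nonneg (sq_nonneg _) (hw0 _)), hwK]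
    exact le_of_eq (by ring)
  have hI2 : IntegrableOn (fun z : ℝ × EuclideanSpace ℝ (Fin 3) => |p z.1 z.2| * w z.2) (I ×ˢ univ) volume := by
    refine hgP.mono' (hpam.mul (cont_ae hwc)) (Eventually.of_forall fun z => ?_)
    rw [Real.norm_eq_abs, abs_of_nonneg (mul_nonneg (abs_nonneg _) (hw0 _)), hwK]
    exact le_of_eq (by ring)
  have hI3 : IntegrableOn (fun z : ℝ × EuclideanSpace ℝ (Fin 3) => ‖u z.1 z.2‖ ^ 2 * (‖fderiv ℝ Φ z.2‖ / (1 + ‖z.2‖)))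
      (I ×ˢ univ) volume := by
    refine hgU.mono' (hu2m.mul (cont_ae hq1c)) (Eventually.of_forall fun z => ?_)
    rw [Real.norm_eq_abs, abs_of_nonneg (mul_nonneg (sq_nonneg _) (by positivity))]
    calc ‖u z.1 z.2‖ ^ 2 * (‖fderiv ℝ Φ z.2‖ / (1 + ‖z.2‖)) ≤ ‖u z.1 z.2‖ ^ 2 * (K * ((1 + ‖z.2‖) ^ 3)⁻¹) :=
          mul_le_mul_of_nonneg_left (hW1 z.2) (sq_nonneg _)
      _ = K * (‖u z.1 z.2‖ ^ 2 * ((1 + ‖z.2‖) ^ 3)⁻¹) := by ring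
  have hI4 : IntegrableOn (fun z : ℝ × EuclideanSpace ℝ (Fin 3) => |p z.1 z.2| * (‖fderiv ℝ Φ z.2‖ / (1 + ‖z.2‖)))
      (I ×ˢ univ) volume := by
    refine hgP.mono' (hpam.mul (cont_ae hq1c)) (Eventually.of_forall fun z => ?_)
    rw [Real.norm_eq_abs, abs_of_nonneg (mul_nonneg (abs_nonneg _) (by positivity))]
    calc |p z.1 z.2| * (‖fderiv ℝ Φ z.2‖ / (1 + ‖z.2‖)) ≤ |p z.1 z.2| * (K * ((1 + ‖z.2‖) ^ 3)⁻¹) :=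
          mul_le_mul_of_nonneg_left (hW1 z.2) (abs_nonneg _)
      _ = K * (|p z.1 z.2| * ((1 + ‖z.2‖) ^ 3)⁻¹) := by ring
  have hI5 : IntegrableOn (fun z : ℝ × EuclideanSpace ℝ (Fin 3) => ‖u z.1 z.2‖ ^ 2 * (|Φ z.2| / (1 + ‖z.2‖) ^ 2))
      (I ×ˢ univ) volume := by
    refine hgU.mono' (hu2m.mul (cont_ae hq2c)) (Eventually.of_forall fun z => ?_)
    rw [Real.norm_eq_abs, abs_of_nonneg (mul_nonneg (sq_nonneg _) (by positivity))]
    calc ‖u z.1 z.2‖ ^ 2 * (|Φ z.2| / (1 + ‖z.2‖) ^ 2) ≤ ‖u z.1 z.2‖ ^ 2 * (K * ((1 + ‖z.2‖) ^ 3)⁻¹) :=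
          mul_le_mul_of_nonneg_left (hW2 z.2) (sq_nonneg _)
      _ = K * (‖u z.1 z.2‖ ^ 2 * ((1 + ‖z.2‖) ^ 3)⁻¹) := by ring
  have hI6 : IntegrableOn (fun z : ℝ × EuclideanSpace ℝ (Fin 3) => |p z.1 z.2| * (|Φ z.2| / (1 + ‖z.2‖) ^ 2))
      (I ×ˢ univ) volume := by
    refine hgP.mono' (hpam.mul (cont_ae hq2c)) (Eventually.of_forall fun z => ?_)
    rw [Real.norm_eq_abs, abs_of_nonneg (mul_nonneg (abs_nonneg _) (by positivity))]
    calc |p z.1 z.2| * (|Φ z.2| / (1 + ‖z.2‖) ^ 2) ≤ |p z.1 z.2| * (K * ((1 + ‖z.2‖) ^ 3)⁻¹) :=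
          mul_le_mul_of_nonneg_left (hW2 z.2) (abs_nonneg _)
      _ = K * (|p z.1 z.2| * ((1 + ‖z.2‖) ^ 3)⁻¹) := by ring
  -- the identity on the window
  have hsolI : IsDistributionalNSSolutionOn (slab (EuclideanSpace ℝ (Fin 3)) I isOpen_Ioo) 0 0 u p :=
    IsDistributionalNSSolutionOn.mono_holds hsw.distributional (slab_mono hWs)
  have hid := hsolI.ae_integral_hessian_apply_add_integral_pressure_mul_laplacian_eq_zero hΦ hwH hI1 hI2 hI3 hI4 hI5 hI6
  -- the two space–time integrands and their slice integrability (Fubini)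
  have happ : Continuous fun q : (EuclideanSpace ℝ (Fin 3) →L[ℝ] ℝ) × EuclideanSpace ℝ (Fin 3) => q.1 q.2 :=
    isBoundedBilinearMap_apply.continuous
  have happ2 : Continuous fun q : (EuclideanSpace ℝ (Fin 3) →L[ℝ] EuclideanSpace ℝ (Fin 3) →L[ℝ] ℝ) × EuclideanSpace ℝ (Fin 3) =>
      q.1 q.2 := isBoundedBilinearMap_apply.continuous
  have hG1m : AEStronglyMeasurable (fun z : ℝ × EuclideanSpace ℝ (Fin 3) =>
      fderiv ℝ (fderiv ℝ Φ) z.2 (u z.1 z.2) (u z.1 z.2)) μ := by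
    have h1 : AEStronglyMeasurable (fun z : ℝ × EuclideanSpace ℝ (Fin 3) =>
        (fderiv ℝ (fderiv ℝ Φ) z.2, uncurry u z)) μ :=
      ((hD2c.comp continuous_snd).aestronglyMeasurable).prodMk hum'
    have h2 : AEStronglyMeasurable (fun z : ℝ × EuclideanSpace ℝ (Fin 3) => fderiv ℝ (fderiv ℝ Φ) z.2 (uncurry u z)) μ :=
      happ2.comp_aestronglyMeasurable h1
    exact happ.comp_aestronglyMeasurable (h2.prodMk hum')
  have hG2m : AEStronglyMeasurable (fun z : ℝ × EuclideanSpace ℝ (Fin 3) => p z.1 z.2 * Δ Φ z.2) μ :=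
    hpm'.mul (cont_ae hLc)
  have hG1 : Integrable (fun z : ℝ × EuclideanSpace ℝ (Fin 3) => fderiv ℝ (fderiv ℝ Φ) z.2 (u z.1 z.2) (u z.1 z.2)) μ := by
    refine hgU.mono' hG1m (Eventually.of_forall fun z => ?_)
    rw [Real.norm_eq_abs]
    calc |fderiv ℝ (fderiv ℝ Φ) z.2 (u z.1 z.2) (u z.1 z.2)| ≤ w z.2 * ‖u z.1 z.2‖ ^ 2 := hwH _ _
      _ = K * (‖u z.1 z.2‖ ^ 2 * ((1 + ‖z.2‖) ^ 3)⁻¹) := by rw [hwK]; ring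
  have hG2 : Integrable (fun z : ℝ × EuclideanSpace ℝ (Fin 3) => p z.1 z.2 * Δ Φ z.2) μ := by
    refine hgP3.mono' hG2m (Eventually.of_forall fun z => ?_)
    rw [norm_mul, Real.norm_eq_abs, Real.norm_eq_abs]
    calc |p z.1 z.2| * |Δ Φ z.2| ≤ |p z.1 z.2| * (3 * w z.2) := mul_le_mul_of_nonneg_left (abs_laplacian_le hwH _) (abs_nonneg _)
      _ = 3 * K * (|p z.1 z.2| * ((1 + ‖z.2‖) ^ 3)⁻¹) := by rw [hwK]; ring
  have hμprod : μ = ((volume : Measure ℝ).restrict I).prod (volume : Measure (EuclideanSpace ℝ (Fin 3))) := by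
    rw [hμ, Measure.volume_eq_prod, Measure.restrict_prod_eq_prod_univ]
  rw [hμprod] at hG1 hG2
  have hs1 := hG1.prod_right_ae
  have hs2 := hG2.prod_right_ae
  filter_upwards [hid, hs1, hs2] with t ht h1 h2
  exact ⟨h1, h2, ht⟩

/-! ### The stub, unfolded -/

/-- **A1 `stub_weightedVirial` of the line `pressure-floor`, signature unfolded** (`InClass ρ u p H c`, `IsNewtonianWeight Φ`,
`WeightedVirial u p` are the line's abbreviations): every member of Seregin's power-gauged ancient Euler class (`ρ > 0`) satisfies,
for every Newtonian weight `Φ` and almost every `t < 0`, the slicewise weighted virial identity `∫ D²Φ(u(t),u(t)) dx + ∫ p(t) ΔΦ dx = 0`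
with both slice integrands integrable.  Windows `(−n−1, 0)` by `weightedVirial_window`, exhausting `(−∞, 0)`.
[cite: Chae2008Weighted, Thm 1.1 (proof, §2)] -/
theorem weightedVirial_of_inClass :
    ∀ ρ : ℝ, 0 < ρ →
      ∀ (u : ℝ → EuclideanSpace ℝ (Fin 3) → EuclideanSpace ℝ (Fin 3)) (p : ℝ → EuclideanSpace ℝ (Fin 3) → ℝ)
        (H : ℝ → EuclideanSpace ℝ (Fin 3) → EuclideanSpace ℝ (Fin 3) →L[ℝ] EuclideanSpace ℝ (Fin 3)) (c : ℝ≥0),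
        (IsSuitableWeakSolutionOn (slab (EuclideanSpace ℝ (Fin 3)) (Set.Iio 0) isOpen_Iio) 0 0 u p ∧
            HasWeakSpatialGradientOn (slab (EuclideanSpace ℝ (Fin 3)) (Set.Iio 0) isOpen_Iio) u H ∧
            (∀ a : ℝ, 0 < a →
              ENNReal.ofReal (a ^ (2 * ρ)) * cknA a (0 : ℝ × EuclideanSpace ℝ (Fin 3)) u +
                    ENNReal.ofReal (a ^ ρ) * cknE a (0 : ℝ × EuclideanSpace ℝ (Fin 3)) H +
                  ENNReal.ofReal (a ^ (2 * ρ)) * cknD a (0 : ℝ × EuclideanSpace ℝ (Fin 3)) p ≤ (c : ℝ≥0∞))) →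
          ∀ Φ : EuclideanSpace ℝ (Fin 3) → ℝ,
            (ContDiff ℝ ∞ Φ ∧ ∃ K : ℝ, ∀ x : EuclideanSpace ℝ (Fin 3),
              |Φ x| ≤ K / (1 + ‖x‖) ∧ ‖fderiv ℝ Φ x‖ ≤ K / (1 + ‖x‖) ^ 2 ∧
                ∀ v : EuclideanSpace ℝ (Fin 3), |fderiv ℝ (fderiv ℝ Φ) x v v| ≤ K / (1 + ‖x‖) ^ 3 * ‖v‖ ^ 2) →
            ∀ᵐ t ∂(volume.restrict (Set.Iio (0 : ℝ))),
              Integrable (fun x : EuclideanSpace ℝ (Fin 3) => fderiv ℝ (fderiv ℝ Φ) x (u t x) (u t x)) ∧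
                Integrable (fun x : EuclideanSpace ℝ (Fin 3) => p t x * Δ Φ x) ∧
                  (∫ x, fderiv ℝ (fderiv ℝ Φ) x (u t x) (u t x)) + ∫ x, p t x * Δ Φ x = 0 := by
  intro ρ hρ u p H c hcls Φ hΦw
  obtain ⟨hsw, hH, hgauge⟩ := hcls
  obtain ⟨hΦ, K, hK⟩ := hΦw
  -- measurability and the two gauges
  have hum : AEStronglyMeasurable (uncurry u)
      (volume.restrict (Iio (0 : ℝ) ×ˢ (univ : Set (EuclideanSpace ℝ (Fin 3))))) := by
    have := hH.locallyIntegrableOn.aestronglyMeasurable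
    simpa [slab] using this
  have hpm : AEStronglyMeasurable (uncurry p)
      (volume.restrict (Iio (0 : ℝ) ×ˢ (univ : Set (EuclideanSpace ℝ (Fin 3))))) := by
    have := hsw.distributional.2.2.1.aestronglyMeasurable
    simpa [slab] using this
  have hA : ∀ a : ℝ, 0 < a → ENNReal.ofReal (a ^ (2 * ρ)) *
      cknA a (0 : ℝ × EuclideanSpace ℝ (Fin 3)) u ≤ (c : ℝ≥0∞) :=
    fun a ha => le_trans (le_trans le_self_add le_self_add) (hgauge a ha)
  have hD : ∀ a : ℝ, 0 < a → ENNReal.ofReal (a ^ (2 * ρ)) *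
      cknD a (0 : ℝ × EuclideanSpace ℝ (Fin 3)) p ≤ (c : ℝ≥0∞) :=
    fun a ha => le_trans le_add_self (hgauge a ha)
  -- windows `(-(n+1), 0)` exhaust `(-∞, 0)`
  have hwin : ∀ n : ℕ, ∀ᵐ t ∂(volume.restrict (Ioo (-((n : ℝ) + 1)) 0)),
      Integrable (fun x : EuclideanSpace ℝ (Fin 3) => fderiv ℝ (fderiv ℝ Φ) x (u t x) (u t x)) ∧
        Integrable (fun x : EuclideanSpace ℝ (Fin 3) => p t x * Δ Φ x) ∧
          (∫ x, fderiv ℝ (fderiv ℝ Φ) x (u t x) (u t x)) + ∫ x, p t x * Δ Φ x = 0 := fun n =>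
    weightedVirial_window hρ.le hsw hum hpm hA hD hΦ hK (by linarith) le_rfl
  have hU : (Iio (0 : ℝ)) = ⋃ n : ℕ, Ioo (-((n : ℝ) + 1)) 0 := by
    ext t
    simp only [mem_Iio, mem_iUnion, mem_Ioo]
    constructor
    · intro ht
      obtain ⟨n, hn⟩ := exists_nat_gt (-t)
      exact ⟨n, by linarith, ht⟩
    · rintro ⟨n, -, h2⟩
      exact h2
  rw [hU, ae_restrict_iUnion_iff]
  exact hwin

end Summit.NavierStokesRegularity.NavierStokesRegularity.Theorems.PowerGaugeEulerLiouville.PressureFloor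

end
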